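import Literature.NumberTheory.Automorphic.RelNormOneTorusArchCircles
import Literature.NumberTheory.Automorphic.UnitaryLineCharacters
import HarnessLib

/-!
# Uniqueness of the archimedean type of a character of `[U(W)]`, and the one-place subtori

Topic `NumberTheory/Automorphic`; namespace `Literature.NumberTheory.Automorphic` (sub-namespace `UnitaryLineChar`).
For a hermitian line `W` over a CM extension `L/L⁺` the archimedean torus `U(W)(L⁺ ⊗ ℝ) = relNormOneInfUnits L⁺ L`
IS `∏_{w ∣ ∞} U(1)` (`relNormOneInfUnitsEquivCircles`, file `RelNormOneTorusArchCircles`).  Consequences: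

* § 1 `forall_circle_zpow_eq_one_iff : (∀ z : U(1), z ^ k = 1) ↔ k = 0` (the tree's
  `Literature.Analysis.Complex.exists_norm_eq_one_zpow_ne_one`);
* § 2 **the archimedean type is determined by the weight**: `archWeightCircle_injective`, `archWeight_injective`
  (`archWeight L m = archWeight L m' → m = m'`), `archWeight_neg`;
* § 3 the ONE-PLACE SUBTORI `archCoord L w : U(1) →* U(W)(L⁺ ⊗ ℝ)` (coordinate `z` at `w`, `1` elsewhere;
  continuous), `archPlaceChars_archCoord`, `archWeightCircle_archCoord : w_m (archCoord w z) = z ^ (m w)`, every `t`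
  is the product of its one-place components (`eq_prod_archCoord`), homomorphisms out of the torus are determined on
  the subtori (`monoidHom_ext_archCoord`);
* § 4 for continuous unitary characters `χ` of `[U(W)] = relNormOneIdeles L⁺ L ⧸ relNormOneRat L⁺ L`:
  **`UnitaryLineChar.HasArchType.unique`** (a character has at most one archimedean type — PerL-style "which DEFINES
  `e_b ∈ ℤ`"), `HasArchType.inv` (type `-m` for `χ⁻¹`), the literal per-place reading
  **`hasArchType_iff_forall_place : HasArchType L χ m ↔ ∀ w z, χ (cl (archCoord L w z)) = z ^ (m w)`**, and the same
  indexed by the REAL PLACES `b` of `L⁺` through Mathlib's `IsCMField.equivInfinitePlace L : InfinitePlace L ≃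
  InfinitePlace L⁺` (`forall_realPlace_iff_hasArchType`, `exists_unitaryLineChar_forall_realPlace` — for every
  `e : (b) → ℤ` an automorphic character with `χ_b(u) = u ^ (e b)` at every real place).

Everything is proved (Mathlib + tree); no named facts.  Port of the HodgeCM publication cell's `PerL34/SeesawChars`
§§0–1 (2026-08-18) re-based on the tree.  Reference for the ambient facts: V. Platonov, A. Rapinchuk, *Algebraic
Groups and Number Theory* (1994), § 6.2 [cite: PlatonovRapinchuk1994, §6.2]; A. Weil, *Basic Number Theory* (1967),
Ch. VII § 3 (characters of compact groups) [cite: WeilBNT1967, Ch. VII §3].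
-/

set_option autoImplicit false

noncomputable section

open _root_.Topology _root_.Set _root_.Function
open NumberField InfinitePlace IsDedekindDomain

namespace Literature.NumberTheory.Automorphic

/-! ## § 1. `z ↦ z ^ k` on `U(1)` is trivial only for `k = 0` -/

/-- `(∀ z : U(1), z ^ k = 1) ↔ k = 0`. [folklore] -/
theorem forall_circle_zpow_eq_one_iff (k : ℤ) : (∀ z : Circle, z ^ k = 1) ↔ k = 0 := by
  refine ⟨fun h => ?_, fun h z => by rw [h, zpow_zero]⟩
  by_contra hk
  obtain ⟨ζ, hζ1, hζk⟩ := Literature.Analysis.Complex.exists_norm_eq_one_zpow_ne_one hk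
  have hz := h ⟨ζ, mem_sphere_zero_iff_norm.mpr hζ1⟩
  exact hζk (by rw [← Circle.coe_one, ← hz, Circle.coe_zpow])

/-! ## § 2. The archimedean type of a weight is unique -/

section ArchType

variable (L : Type) [Field L] [NumberField L] [IsCMField L]

open scoped Classical in
/-- On a coordinate element `t` (`ι_{w₀}(t_{w₀}) = z`, `ι_w(t_w) = 1` for `w ≠ w₀`) the weight of type `m` is
`z ^ (m w₀)`. [folklore] -/
theorem archWeightCircle_apply_of_archPlaceChars_eq_mulSingle (m : InfinitePlace L → ℤ) (w₀ : InfinitePlace L)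
    (z : Circle) (t : relNormOneInfUnits (maximalRealSubfield L) L)
    (ht : archPlaceChars L t = Pi.mulSingle (M := fun _ => Circle) w₀ z) :
    archWeightCircle L m t = z ^ (m w₀) := by
  change (∏ w, (archPlaceChars L t w) ^ (m w)) = z ^ (m w₀)
  rw [ht, Finset.prod_eq_single w₀]
  · rw [Pi.mulSingle_eq_same]
  · intro w _ hw
    rw [Pi.mulSingle_eq_of_ne hw, one_zpow]
  · intro h
    exact absurd (Finset.mem_univ w₀) h

variable {L}

/-- **The archimedean type of a unitary weight is unique** (circle-valued weights). [folklore] -/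
theorem archWeightCircle_injective : Function.Injective (archWeightCircle L) := by
  classical
  intro m m' h
  funext w₀
  have key : ∀ z : Circle, z ^ (m w₀ - m' w₀) = 1 := by
    intro z
    obtain ⟨t, ht⟩ := archPlaceChars_surjective L (Pi.mulSingle (M := fun _ => Circle) w₀ z)
    have h1 := archWeightCircle_apply_of_archPlaceChars_eq_mulSingle L m w₀ z t ht
    have h2 := archWeightCircle_apply_of_archPlaceChars_eq_mulSingle L m' w₀ z t ht
    rw [h] at h1
    rw [zpow_sub, h1.symm.trans h2, mul_inv_cancel]
  exact sub_eq_zero.mp ((forall_circle_zpow_eq_one_iff _).mp key)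

/-- **The archimedean type of a weight is unique**: `archWeight L m = archWeight L m' → m = m'`. [folklore] -/
theorem archWeight_injective : Function.Injective (archWeight L) := by
  intro m m' h
  refine archWeightCircle_injective (MonoidHom.ext fun t => Subtype.val_injective ?_)
  have := DFunLike.congr_fun h t
  rwa [archWeight_apply, archWeight_apply] at this

/-- `w_{-m} = w_m⁻¹`. [folklore] -/
theorem archWeight_neg (m : InfinitePlace L → ℤ) (t : relNormOneInfUnits (maximalRealSubfield L) L) :
    archWeight L (-m) t = (archWeight L m t)⁻¹ := by
  have h := archWeight_add L m (-m) t
  rw [add_neg_cancel, archWeight_zero] at h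
  exact eq_inv_of_mul_eq_one_right h.symm

/-! ## § 3. The one-place subtori -/

variable (L)

open scoped Classical in
/-- **The one-place subtorus** `archCoord L w : U(1) →* U(W)(L⁺ ⊗ ℝ)`: coordinate `z` at `w`, `1` at the other places
(through `relNormOneInfUnitsEquivCircles L : U(W)(L⁺ ⊗ ℝ) ≃ₜ* ∏_w U(1)`). [folklore] -/
def archCoord (w : InfinitePlace L) : Circle →* relNormOneInfUnits (maximalRealSubfield L) L :=
  (relNormOneInfUnitsEquivCircles L).symm.toMonoidHom.comp
    (MonoidHom.mulSingle (fun _ : InfinitePlace L => Circle) w)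

open scoped Classical in
/-- The weight characters of `archCoord L w z`: `z` at `w`, `1` elsewhere. [folklore] -/
theorem archPlaceChars_archCoord (w : InfinitePlace L) (z : Circle) :
    archPlaceChars L (archCoord L w z) = Pi.mulSingle (M := fun _ => Circle) w z :=
  archPlaceChars_relNormOneInfUnitsEquivCircles_symm L _

open scoped Classical in
/-- The one-place subtori are continuous. [folklore] -/
theorem continuous_archCoord (w : InfinitePlace L) : Continuous (archCoord L w) :=
  (relNormOneInfUnitsEquivCircles L).symm.continuous.comp
    (continuous_mulSingle (A := fun _ : InfinitePlace L => Circle) w)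

/-- `archCoord L w` as a continuous homomorphism. [folklore] -/
def archCoordC (w : InfinitePlace L) : ContinuousMonoidHom Circle (relNormOneInfUnits (maximalRealSubfield L) L) :=
  { archCoord L w with continuous_toFun := continuous_archCoord L w }

/-- Values of `archCoordC` (definitional). [folklore] -/
@[simp] theorem archCoordC_apply (w : InfinitePlace L) (z : Circle) : archCoordC L w z = archCoord L w z := rfl

/-- The weight of type `m` on the one-place subtorus at `w` is `z ↦ z ^ (m w)`. [folklore] -/
theorem archWeightCircle_archCoord (m : InfinitePlace L → ℤ) (w : InfinitePlace L) (z : Circle) :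
    archWeightCircle L m (archCoord L w z) = z ^ (m w) :=
  archWeightCircle_apply_of_archPlaceChars_eq_mulSingle L m w z _ (archPlaceChars_archCoord L w z)

/-- The same read in `ℂ`. [folklore] -/
theorem archWeight_archCoord (m : InfinitePlace L → ℤ) (w : InfinitePlace L) (z : Circle) :
    archWeight L m (archCoord L w z) = (((z ^ (m w) : Circle)) : ℂ) := by
  rw [archWeight_apply, archWeightCircle_archCoord]

open scoped Classical in
/-- Every element of `U(W)(L⁺ ⊗ ℝ)` is the (finite) product of its one-place components. [folklore] -/
theorem eq_prod_archCoord (t : relNormOneInfUnits (maximalRealSubfield L) L) :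
    t = ∏ w, archCoord L w (archPlaceChars L t w) := by
  apply (relNormOneInfUnitsEquivCircles L).injective
  rw [map_prod]
  simp only [relNormOneInfUnitsEquivCircles_apply, archPlaceChars_archCoord]
  exact (Finset.univ_prod_mulSingle _).symm

/-- Two homomorphisms out of `U(W)(L⁺ ⊗ ℝ)` into a commutative monoid agree iff they agree on every one-place
subtorus. [folklore] -/
theorem monoidHom_ext_archCoord {M : Type} [CommMonoid M] {f g : relNormOneInfUnits (maximalRealSubfield L) L →* M}
    (h : ∀ (w : InfinitePlace L) (z : Circle), f (archCoord L w z) = g (archCoord L w z)) : f = g := by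
  refine MonoidHom.ext fun t => ?_
  rw [eq_prod_archCoord L t, map_prod, map_prod]
  exact Finset.prod_congr rfl fun w _ => h w _

end ArchType

/-! ## § 4. Characters of `[U(W)]`: the type is unique; per-place and per-real-place readings -/

namespace UnitaryLineChar

variable {L : Type} [Field L] [NumberField L] [IsCMField L]

/-- Two archimedean types of one character give the same weight. [folklore] -/
theorem HasArchType.archWeight_eq
    {χ : ContinuousMonoidHom (relNormOneIdeles (maximalRealSubfield L) L ⧸ relNormOneRat (maximalRealSubfield L) L)
      Circle} {m m' : InfinitePlace L → ℤ} (h : HasArchType L χ m) (h' : HasArchType L χ m') :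
    archWeight L m = archWeight L m' := by
  rw [hasArchType_iff] at h h'
  exact MonoidHom.ext fun t => (h t).symm.trans (h' t)

/-- **A continuous unitary character of `[U(W)]` has at most one archimedean type.** [folklore] -/
theorem HasArchType.unique
    {χ : ContinuousMonoidHom (relNormOneIdeles (maximalRealSubfield L) L ⧸ relNormOneRat (maximalRealSubfield L) L)
      Circle} {m m' : InfinitePlace L → ℤ} (h : HasArchType L χ m) (h' : HasArchType L χ m') : m = m' :=
  archWeight_injective (h.archWeight_eq h')

/-- If `χ` has type `m` then `χ⁻¹ = χ̄` has type `-m`. [folklore] -/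
theorem HasArchType.inv
    {χ : ContinuousMonoidHom (relNormOneIdeles (maximalRealSubfield L) L ⧸ relNormOneRat (maximalRealSubfield L) L)
      Circle} {m : InfinitePlace L → ℤ} (h : HasArchType L χ m) : HasArchType L χ⁻¹ (-m) := by
  rw [hasArchType_iff] at h ⊢
  intro t
  rw [archWeight_neg, ← h t, ← Circle.coe_inv]
  rfl

/-- The set of archimedean types of a character is a subsingleton. [folklore] -/
theorem subsingleton_setOf_hasArchType
    (χ : ContinuousMonoidHom (relNormOneIdeles (maximalRealSubfield L) L ⧸ relNormOneRat (maximalRealSubfield L) L)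
      Circle) : Set.Subsingleton {m : InfinitePlace L → ℤ | HasArchType L χ m} :=
  fun _ h _ h' => HasArchType.unique h h'

/-- **"`χ_b(u) = u^{e_b}` at every real place", literally**: `χ` has archimedean type `m` iff on each one-place
subtorus at the infinite place `w` of `L` the character `χ ∘ cl` is `z ↦ z ^ (m w)`. [folklore] -/
theorem hasArchType_iff_forall_place
    (χ : ContinuousMonoidHom (relNormOneIdeles (maximalRealSubfield L) L ⧸ relNormOneRat (maximalRealSubfield L) L)
      Circle) (m : InfinitePlace L → ℤ) :
    HasArchType L χ m ↔ ∀ (w : InfinitePlace L) (z : Circle),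
      χ (relNormOneInfToQuot (maximalRealSubfield L) L (archCoord L w z)) = z ^ (m w) := by
  constructor
  · intro h w z
    rw [h (archCoord L w z), archWeightCircle_archCoord]
  · intro h
    have key : (χ : (relNormOneIdeles (maximalRealSubfield L) L ⧸ relNormOneRat (maximalRealSubfield L) L) →*
          Circle).comp (relNormOneInfToQuot (maximalRealSubfield L) L) = archWeightCircle L m :=
      monoidHom_ext_archCoord L fun w z => by
        rw [MonoidHom.comp_apply, archWeightCircle_archCoord]
        exact h w z
    intro t
    have := DFunLike.congr_fun key t
    rw [MonoidHom.comp_apply] at this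
    exact this

/-- Types indexed by the REAL PLACES `b` of `L⁺` (Mathlib `IsCMField.equivInfinitePlace L : (w ∣ ∞ of L) ≃ (b of L⁺)`):
`χ_b(u) = u ^ (e b)` on the subtorus at the place above `b`, for every `b`, iff `χ` has type `e ∘ (w ↦ w|_{L⁺})`.
[folklore] -/
theorem forall_realPlace_iff_hasArchType
    (χ : ContinuousMonoidHom (relNormOneIdeles (maximalRealSubfield L) L ⧸ relNormOneRat (maximalRealSubfield L) L)
      Circle) (e : InfinitePlace (maximalRealSubfield L) → ℤ) :
    (∀ (b : InfinitePlace (maximalRealSubfield L)) (u : Circle),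
        χ (relNormOneInfToQuot (maximalRealSubfield L) L
          (archCoord L ((IsCMField.equivInfinitePlace L).symm b) u)) = u ^ (e b)) ↔
      HasArchType L χ (e ∘ IsCMField.equivInfinitePlace L) := by
  rw [hasArchType_iff_forall_place]
  constructor
  · intro h w z
    have := h (IsCMField.equivInfinitePlace L w) z
    rwa [Equiv.symm_apply_apply] at this
  · intro h b u
    rw [h, Function.comp_apply, Equiv.apply_symm_apply]

/-- **PerL-style Lemma "for every `e = (e_b)_b` there is an automorphic character `χ` of `[U(1)]` with
`χ_b(u) = u^{e_b}` at every real place `b`"** — from `exists_unitaryLineChar_hasArchType`. [folklore] -/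
theorem exists_unitaryLineChar_forall_realPlace (e : InfinitePlace (maximalRealSubfield L) → ℤ) :
    ∃ χ : ContinuousMonoidHom
        (relNormOneIdeles (maximalRealSubfield L) L ⧸ relNormOneRat (maximalRealSubfield L) L) Circle,
      ∀ (b : InfinitePlace (maximalRealSubfield L)) (u : Circle),
        χ (relNormOneInfToQuot (maximalRealSubfield L) L
          (archCoord L ((IsCMField.equivInfinitePlace L).symm b) u)) = u ^ (e b) := by
  obtain ⟨χ, hχ⟩ := exists_unitaryLineChar_hasArchType L (e ∘ IsCMField.equivInfinitePlace L)
  exact ⟨χ, (forall_realPlace_iff_hasArchType χ e).mpr hχ⟩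

end UnitaryLineChar

end Literature.NumberTheory.Automorphic

end
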